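import Summits.NavierStokesRegularity.NavierStokesRegularity.Theses.PalasekTowerBreakdown
import Summits.NavierStokesRegularity.FluidComputer.PalasekTowerGermHostMechanismDoorAt
import Summits.NavierStokesRegularity.FluidComputer.PalasekTowerGermHostPotentialAmplifier
import Summits.NavierStokesRegularity.FluidComputer.PalasekTowerStrainDoorAtH2
import Summits.NavierStokesRegularity.FluidComputer.PalasekTowerGermHostApproximantFreeRunAt
import Summits.NavierStokesRegularity.FluidComputer.PalasekTowerGermHostPotentialTruncation

/-!
# `EpisodeBaseT` (crux stmt-NavierStokesRegularity-20303): THE LEVEL-`1` MECHANISM DOOR AT `tuned` IS A THEOREM —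
# the registered stub `stub_mechanism_doorT : StrainDoor.MechanismDoorAt TowerRates.tuned` BY NAME, and the crux
# reduced to its ONE computation stub `StrainDoor.RawCertificateAt TowerRates.tuned`

Cell `ns-blowup`, seat `ns-blowup-ecbridge-3` (g9; D-0074 GROUP C «BRIDGE SUPPORT», lineage `host_preparation`).
Route `PalasekTowerBreakdown` after the RE-BASE (rev 19): `EpisodeBaseT := EpisodeBaseGAt TowerRates.tuned`; LEAD line
`straindoor` (skeleton v3, ns-palasek-20303-p1, registered 2026-08-27T13:05Z) with stubs `stub_mechanism_doorT :
StrainDoor.MechanismDoorAt TowerRates.tuned` and `stub_raw_certificateT : StrainDoor.RawCertificateAt TowerRates.tuned`.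
This file is the end of the `R`-generic DOOR PORT of the E–C lineage (ecbridge-3 g8 L0–L4b, g9 L4c:
`PalasekTowerGermHostCompanionAt` → `…SuperposedFreeRunAt` → `…MechanismDoorAt`) specialised to the tuned register
numerics `TowerRates.tuned_boxNumerics` (`c₃ = 128`, `r = 1/3`). LABEL: E–C typing (KERNEL: theorems only;
`--supports` stmt-NavierStokesRegularity-20303). WHAT THIS IS NOT: not Navier–Stokes evidence — no free run of the
first tuned window meeting the letter and no strain certificate is exhibited; `EpisodeBaseT` appears only as the
conclusion of conditionals; nothing about `RungG 1` or blow-up is asserted.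

* **`palasekTowerBreakdown_mechanismDoorAt_tuned : StrainDoor.MechanismDoorAt TowerRates.tuned`** — THE REGISTERED
  STUB, no hypothesis: for every smooth divergence-free `W` with `tsupport W ⊆ B̄(0, ρ)` (`ρ ≥ 0`) of speed
  `< Y₀(tuned)` and every classical finite-energy FREE Navier–Stokes run (`ν = 1`) on `[1, τfirstAt tuned]` from `W`
  below `(5/3) Y₁ − η` (`η > 0`) showing at `τfirstAt tuned`, inside `‖x‖ ≤ ρ`, the speed `Y₁ + η`, the gradient
  `A₁ + η` and an `N₁`-core loop of circulation `≥ N₁^{β−2} + η` (tuned numbers) — `EpisodeBaseGAt tuned`;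
  `palasekTowerBreakdown_mechanismDoorAt_wide` is the same at the wide base (= p523959 repackaged);
* `palasekTowerBreakdown_episodeBaseT_of_mechanism_freeRun` — the binder form concluding the route's `EpisodeBaseT`
  (`…_of_curl_mechanism_freeRun`: `W = curl A`, `A ∈ C_c^∞`, `‖DA‖ ≤ L`, `4L < Y₀(tuned)` — every static condition closed-form);
* `palasekTowerBreakdown_episodeBaseT_of_certificateAt` / `…_of_certificateSharpAt` /
  **`…_of_rawCertificateAt : StrainDoor.RawCertificateAt TowerRates.tuned → EpisodeBaseT`** — composed with the
  LEAD's strain doors (p528856 / p530553 / p531699): THE CRUX IS NOW EXACTLY ITS ONE COMPUTATION STUB (an explicit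
  datum, an explicit reference flow with its raw residual as the force, and numerals meeting the kernel price);
  `…_of_certificateDataH2` — the same for the route-(B) `H²`-currency letter (`PalasekTowerStrainDoorAtH2`);
* `palasekTowerBreakdown_hostPreparation_tuned` — host preparation at `tuned` (the fallback line `birth`'s stub
  `stub_host_preparationT` by its unfolded text: ∃ pinned rigid quiet tuned schedule with a registered level-`0` stage).

References: S. Palasek, arXiv:2605.13827 §4 [cite: Palasek2026ElementaryModel, §4]; T. Kato, Math. Z. 187 (1984),
Thm. 2–4 [cite: Kato1984, Thm. 2–4]; T. Tao, Anal. PDE 6 (2013), Thm. 5.4 [cite: Tao2011, Thm. 5.4 (ii)+(iv)];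
M. Dashti, J. C. Robinson, SIAM J. Numer. Anal. 46 (2008), Thm. 5 [cite: DashtiRobinson2008, Thm. 5]; A. J. Majda,
A. L. Bertozzi, *Vorticity and Incompressible Flow* (CUP 2002), §1.1 [cite: MajdaBertozziCUP2002, §1.1 (1.11)]; J. C. Robinson,
J. L. Rodrigo, W. Sadowski, CUP 2016 [cite: RobinsonRodrigoSadowskiCUP2016, Thm 9.1 and Thm 1.20].
-/

noncomputable section

-- `Summit.<Summit>.<Problem>` is the tree's mandated summit-side namespace (CONVENTIONS §2); for this
-- single-conjunct summit the two coincide, so the duplicate is deliberate.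
set_option linter.dupNamespace false

namespace Summit.NavierStokesRegularity.NavierStokesRegularity.Theorems

open Set Function MeasureTheory Metric
open scoped ENNReal ContDiff
open Summit.NavierStokesRegularity.NavierStokesRegularity.Theses
open Summit.NavierStokesRegularity.FluidComputer.PalasekTowerClayBridge
open Summit.NavierStokesRegularity.FluidComputer.PalasekTowerClayBridge.Germ
open Literature.Analysis.FluidPDE

/-- **THE LEVEL-`1` MECHANISM DOOR AT THE TUNED RATES — the registered stub `stub_mechanism_doorT` of the line
`straindoor` of the crux `EpisodeBaseT`, BY NAME and with no hypothesis**: ONE classical finite-energy free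
Navier–Stokes run of the first tuned window from a smooth compactly supported divergence-free datum of speed
`< Y₀(tuned)`, under the cap `(5/3) Y₁(tuned) − η`, showing the three level-`1` faces of the tuned register with
margin `η` inside the datum's support radius ⟹ `EpisodeBaseGAt TowerRates.tuned`.
[cite: Palasek2026ElementaryModel, §4] [cite: Kato1984, Thm. 2–4] [cite: Tao2011, Thm. 5.4 (ii)+(iv)] -/
theorem palasekTowerBreakdown_mechanismDoorAt_tuned : StrainDoor.MechanismDoorAt TowerRates.tuned :=
  mechanismDoorAt_of_boxNumerics TowerRates.tuned_boxNumerics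

/-- The same door at the wide base (the landed p523959 `palasekTowerBreakdown_episodeBase_of_mechanism_freeRun`,
repackaged as the `Prop` `StrainDoor.MechanismDoorAt TowerRates.wide`; `Host.τfirstAt wide = Host.τfirst`).
[cite: Palasek2026ElementaryModel, §4] -/
theorem palasekTowerBreakdown_mechanismDoorAt_wide : StrainDoor.MechanismDoorAt TowerRates.wide :=
  mechanismDoorAt_of_boxNumerics TowerRates.wide_boxNumerics

/-- **`EpisodeBaseT` FROM ONE FREE RUN OF A MECHANISM DATUM (binder form).** Let `W : ℝ³ → ℝ³` be smooth,
divergence free, `tsupport W ⊆ B̄(0, ρ)` (`ρ ≥ 0`), of speed `< Y₀(tuned)`, with ONE classical finite-energy free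
Navier–Stokes run `(v, q)` (`ν = 1`) on `[1, τfirstAt tuned]` from `v 1 = W` staying below `(5/3) Y₁(tuned) − η`
(`η > 0`) and showing at `τfirstAt tuned`, inside `‖x‖ ≤ ρ`: `Y₁ + η ≤ ‖v‖`, `A₁ + η ≤ ‖Dv‖`, and an `N₁`-core loop
of circulation `≥ N₁^{β−2} + η` (tuned numbers). Then `EpisodeBaseT`.
[cite: Palasek2026ElementaryModel, §4] [cite: Tao2011, Thm. 5.4 (ii)+(iv)] -/
theorem palasekTowerBreakdown_episodeBaseT_of_mechanism_freeRun
    {W : EuclideanSpace ℝ (Fin 3) → EuclideanSpace ℝ (Fin 3)} {ρ : ℝ}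
    (hW : ContDiff ℝ ∞ W) (hdivW : VectorCalculus.IsDivFree W) (hWsupp : tsupport W ⊆ closedBall 0 ρ)
    (hWlt : ∀ x, ‖W x‖ < TowerRates.tuned.Y 0) (hρ : 0 ≤ ρ)
    {v : ℝ → EuclideanSpace ℝ (Fin 3) → EuclideanSpace ℝ (Fin 3)} {q : ℝ → EuclideanSpace ℝ (Fin 3) → ℝ}
    (hv : IsClassicalNSSolutionOn (Icc 1 (Host.τfirstAt TowerRates.tuned)) 1 0 v q) (hv1 : v 1 = W)
    (hvE : ∃ C : ℝ≥0∞, C < ⊤ ∧ ∀ t ∈ Icc (1 : ℝ) (Host.τfirstAt TowerRates.tuned), ∫⁻ x, ‖v t x‖ₑ ^ 2 ≤ C)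
    {η : ℝ} (hη : 0 < η)
    (hcap : ∀ t ∈ Icc (1 : ℝ) (Host.τfirstAt TowerRates.tuned), ∀ x, ‖v t x‖ ≤ 5 / 3 * TowerRates.tuned.Y 1 - η)
    (hspeed : ∃ x, ‖x‖ ≤ ρ ∧ TowerRates.tuned.Y 1 + η ≤ ‖v (Host.τfirstAt TowerRates.tuned) x‖)
    (hstrain : ∃ x, ‖x‖ ≤ ρ ∧ TowerRates.tuned.A 1 + η ≤ ‖fderiv ℝ (v (Host.τfirstAt TowerRates.tuned)) x‖)
    (hcore : ∃ (x : EuclideanSpace ℝ (Fin 3)) (γ : ℝ → EuclideanSpace ℝ (Fin 3)),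
      ‖x‖ ≤ ρ ∧ ContDiff ℝ 1 γ ∧ γ 0 = γ 1 ∧
      (∀ s ∈ Icc (0 : ℝ) 1, γ s ∈ closedBall x (1 / TowerRates.tuned.N 1)) ∧
      (∀ s ∈ Icc (0 : ℝ) 1, ‖deriv γ s‖ ≤ 8 * Real.pi / TowerRates.tuned.N 1) ∧
      TowerRates.tuned.N 1 ^ (TowerRates.tuned.β - 2) + η ≤ circulation (v (Host.τfirstAt TowerRates.tuned)) γ) :
    PalasekTowerBreakdown.EpisodeBaseT :=
  palasekTowerBreakdown_mechanismDoorAt_tuned hW hdivW hWsupp hWlt hρ hv hv1 hvE hη hcap hspeed hstrain hcore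

/-- **`EpisodeBaseT` FROM ONE FREE RUN OF THE CURL OF A COMPACTLY SUPPORTED POTENTIAL** (tuned twin of p523959's
curl form): `A ∈ C^∞`, `tsupport A ⊆ B̄(0, ρ)` (`ρ ≥ 0`), `‖DA(x)‖ ≤ L`, `4L < Y₀(tuned)`; ONE classical finite-energy free
run of `curl A` on `[1, τfirstAt tuned]` below `(5/3) Y₁ − η` showing the three tuned level-`1` faces with margin `η > 0` inside
`‖x‖ ≤ ρ` ⟹ `EpisodeBaseT` (every static condition on the datum is closed-form: `contDiff_curl_top`, `isDivFree_curl`,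
`tsupport_curl_subset`, `norm_curl_le_of_fderiv_le`). [cite: Palasek2026ElementaryModel, §4]
[cite: MajdaBertozziCUP2002, §1.1 (1.11)] -/
theorem palasekTowerBreakdown_episodeBaseT_of_curl_mechanism_freeRun
    {A : EuclideanSpace ℝ (Fin 3) → EuclideanSpace ℝ (Fin 3)} {ρ L : ℝ}
    (hA : ContDiff ℝ ∞ A) (hAsupp : tsupport A ⊆ closedBall 0 ρ) (hρ : 0 ≤ ρ)
    (hL : ∀ x, ‖fderiv ℝ A x‖ ≤ L) (h4L : 4 * L < TowerRates.tuned.Y 0)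
    {v : ℝ → EuclideanSpace ℝ (Fin 3) → EuclideanSpace ℝ (Fin 3)} {q : ℝ → EuclideanSpace ℝ (Fin 3) → ℝ}
    (hv : IsClassicalNSSolutionOn (Icc 1 (Host.τfirstAt TowerRates.tuned)) 1 0 v q) (hv1 : v 1 = curl A)
    (hvE : ∃ C : ℝ≥0∞, C < ⊤ ∧ ∀ t ∈ Icc (1 : ℝ) (Host.τfirstAt TowerRates.tuned), ∫⁻ x, ‖v t x‖ₑ ^ 2 ≤ C)
    {η : ℝ} (hη : 0 < η)
    (hcap : ∀ t ∈ Icc (1 : ℝ) (Host.τfirstAt TowerRates.tuned), ∀ x, ‖v t x‖ ≤ 5 / 3 * TowerRates.tuned.Y 1 - η)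
    (hspeed : ∃ x, ‖x‖ ≤ ρ ∧ TowerRates.tuned.Y 1 + η ≤ ‖v (Host.τfirstAt TowerRates.tuned) x‖)
    (hstrain : ∃ x, ‖x‖ ≤ ρ ∧ TowerRates.tuned.A 1 + η ≤ ‖fderiv ℝ (v (Host.τfirstAt TowerRates.tuned)) x‖)
    (hcore : ∃ (x : EuclideanSpace ℝ (Fin 3)) (γ : ℝ → EuclideanSpace ℝ (Fin 3)),
      ‖x‖ ≤ ρ ∧ ContDiff ℝ 1 γ ∧ γ 0 = γ 1 ∧
      (∀ s ∈ Icc (0 : ℝ) 1, γ s ∈ closedBall x (1 / TowerRates.tuned.N 1)) ∧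
      (∀ s ∈ Icc (0 : ℝ) 1, ‖deriv γ s‖ ≤ 8 * Real.pi / TowerRates.tuned.N 1) ∧
      TowerRates.tuned.N 1 ^ (TowerRates.tuned.β - 2) + η ≤ circulation (v (Host.τfirstAt TowerRates.tuned)) γ) :
    PalasekTowerBreakdown.EpisodeBaseT :=
  palasekTowerBreakdown_mechanismDoorAt_tuned (contDiff_curl_top hA) (isDivFree_curl hA) (tsupport_curl_subset hAsupp)
    (fun x => (norm_curl_le_of_fderiv_le hL x).trans_lt h4L) hρ hv hv1 hvE hη hcap hspeed hstrain hcore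

/-- **`EpisodeBaseT` ⟸ ONE STRAIN CERTIFICATE AT `tuned`** (classical letter `StrainDoor.CertificateAt`, p528856).
[cite: Palasek2026ElementaryModel, §4] [cite: DashtiRobinson2008, Thm. 5] -/
theorem palasekTowerBreakdown_episodeBaseT_of_certificateAt
    (hcert : StrainDoor.CertificateAt TowerRates.tuned) : PalasekTowerBreakdown.EpisodeBaseT :=
  episodeBaseGAt_of_boxNumerics_of_certificateAt TowerRates.tuned_boxNumerics hcert

/-- **`EpisodeBaseT` ⟸ ONE NUMERAL STRAIN CERTIFICATE AT `tuned`** (numeral letter `StrainDoor.CertificateSharpAt`,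
p530553). [cite: Palasek2026ElementaryModel, §4] [cite: DashtiRobinson2008, Thm. 5] -/
theorem palasekTowerBreakdown_episodeBaseT_of_certificateSharpAt
    (hcert : StrainDoor.CertificateSharpAt TowerRates.tuned) : PalasekTowerBreakdown.EpisodeBaseT :=
  episodeBaseGAt_of_boxNumerics_of_certificateSharpAt TowerRates.tuned_boxNumerics hcert

/-- **`EpisodeBaseT` ⟸ ONE RAW STRAIN CERTIFICATE AT `tuned`** (RAW letter `StrainDoor.RawCertificateAt`, p531699 —
the registered computation stub `stub_raw_certificateT`): THE CRUX IS EXACTLY ITS ONE COMPUTATION STUB.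
[cite: Palasek2026ElementaryModel, §4] [cite: DashtiRobinson2008, Thm. 5] -/
theorem palasekTowerBreakdown_episodeBaseT_of_rawCertificateAt
    (hcert : StrainDoor.RawCertificateAt TowerRates.tuned) : PalasekTowerBreakdown.EpisodeBaseT :=
  episodeBaseGAt_of_boxNumerics_of_rawCertificateAt TowerRates.tuned_boxNumerics hcert

/-- **`EpisodeBaseT` ⟸ ONE `H²`-CURRENCY STRAIN CERTIFICATE AT `tuned`** (route (B) letter `StrainDoor.CertificateDataH2`,
the LEAD's `PalasekTowerStrainDoorAtH2`: no short smoothing window, fee at the `H¹`/`H²` level).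
[cite: Palasek2026ElementaryModel, §4] [cite: RobinsonRodrigoSadowskiCUP2016, Thm 9.1 and Thm 1.20] -/
theorem palasekTowerBreakdown_episodeBaseT_of_certificateDataH2
    {U : EuclideanSpace ℝ (Fin 3) → EuclideanSpace ℝ (Fin 3)} {ρ : ℝ}
    {w r : ℝ → EuclideanSpace ℝ (Fin 3) → EuclideanSpace ℝ (Fin 3)} {ϖ : ℝ → EuclideanSpace ℝ (Fin 3) → ℝ}
    {G σ₂ σ₃ Rr L H₁ ψ₁ ψ₂ X₁ : ℝ → ℝ} {Bw E₀ κ μ D₁ Ψ₁ D₂ Ψ₂ δ η : ℝ}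
    (c : StrainDoor.CertificateDataH2 TowerRates.tuned U ρ w r ϖ G σ₂ σ₃ Rr L H₁ ψ₁ ψ₂ X₁ Bw E₀ κ μ D₁ Ψ₁ D₂ Ψ₂ δ η) :
    PalasekTowerBreakdown.EpisodeBaseT :=
  StrainDoor.episodeBaseGAt_of_mechanismDoorAt_of_certificateDataH2 palasekTowerBreakdown_mechanismDoorAt_tuned c

/-- **HOST PREPARATION AT THE TUNED RATES** — the statement `HostPreparationT` of the stub
`stub_host_preparationT` of the fallback line `birth` (Cruxes/EpisodeBaseT/Lines/birth.lean v2), BY ITS UNFOLDED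
TEXT and with no hypothesis: some pinned (`Λ = 8`, `θ = 6/5`), rigid, quiet schedule on the tuned rates carries a
globally anchored registered stage at LEVEL `0` (the germ schedule of a tuned tame carrier).
[cite: Palasek2026ElementaryModel, §3.3] -/
theorem palasekTowerBreakdown_hostPreparation_tuned :
    ∃ S : Schedule TowerRates.tuned, S.Pins 8 (6 / 5) ∧ S.Rigid ∧ S.Quiet ∧
      Nonempty (Stage 1 TowerRates.tuned S (Margins.routeG TowerRates.tuned) 0) :=
  exists_hostPreparation_of_boxNumerics TowerRates.tuned_boxNumerics

/-! ## Appendix (g9, append): Schwartz mechanism data at `tuned` -/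

/-- **`EpisodeBaseT` FROM ONE FREE RUN OF A SCHWARTZ MECHANISM DATUM WITH COMPACT APPROXIMANTS** (tuned twin of
p523959's approximable form): `W` Schwartz (`HasRapidSpatialDecay W`) with ONE classical finite-energy free run on
`[1, τfirstAt tuned]` below `(5/3) Y₁ − η` showing the three tuned level-`1` faces with margin `η > 0` inside `‖x‖ ≤ ρ`
(`ρ ≥ 0`), and, at every sup distance `δ > 0`, a smooth divergence-free approximant `W'` with `tsupport W' ⊆ B̄(0, ρ')`,
`ρ ≤ ρ'`, speed `< Y₀(tuned)` ⟹ `EpisodeBaseT` (the approximable door at `R`, `Germ.exists_compact_approximant_freeRunAt`).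
[cite: Palasek2026ElementaryModel, §4] [cite: Tao2011, Thm. 5.4 (ii)+(iv)] -/
theorem palasekTowerBreakdown_episodeBaseT_of_approximable_mechanism_freeRun
    {W : EuclideanSpace ℝ (Fin 3) → EuclideanSpace ℝ (Fin 3)} {ρ : ℝ} (hW0 : HasRapidSpatialDecay W) (hρ : 0 ≤ ρ)
    {v : ℝ → EuclideanSpace ℝ (Fin 3) → EuclideanSpace ℝ (Fin 3)} {q : ℝ → EuclideanSpace ℝ (Fin 3) → ℝ}
    (hv : IsClassicalNSSolutionOn (Icc 1 (Host.τfirstAt TowerRates.tuned)) 1 0 v q) (hv1 : v 1 = W)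
    (hvE : ∃ C : ℝ≥0∞, C < ⊤ ∧ ∀ t ∈ Icc (1 : ℝ) (Host.τfirstAt TowerRates.tuned), ∫⁻ x, ‖v t x‖ₑ ^ 2 ≤ C)
    {η : ℝ} (hη : 0 < η)
    (hcap : ∀ t ∈ Icc (1 : ℝ) (Host.τfirstAt TowerRates.tuned), ∀ x, ‖v t x‖ ≤ 5 / 3 * TowerRates.tuned.Y 1 - η)
    (hspeed : ∃ x, ‖x‖ ≤ ρ ∧ TowerRates.tuned.Y 1 + η ≤ ‖v (Host.τfirstAt TowerRates.tuned) x‖)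
    (hstrain : ∃ x, ‖x‖ ≤ ρ ∧ TowerRates.tuned.A 1 + η ≤ ‖fderiv ℝ (v (Host.τfirstAt TowerRates.tuned)) x‖)
    (hcore : ∃ (x : EuclideanSpace ℝ (Fin 3)) (γ : ℝ → EuclideanSpace ℝ (Fin 3)),
      ‖x‖ ≤ ρ ∧ ContDiff ℝ 1 γ ∧ γ 0 = γ 1 ∧
      (∀ s ∈ Icc (0 : ℝ) 1, γ s ∈ closedBall x (1 / TowerRates.tuned.N 1)) ∧
      (∀ s ∈ Icc (0 : ℝ) 1, ‖deriv γ s‖ ≤ 8 * Real.pi / TowerRates.tuned.N 1) ∧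
      TowerRates.tuned.N 1 ^ (TowerRates.tuned.β - 2) + η ≤ circulation (v (Host.τfirstAt TowerRates.tuned)) γ)
    (happrox : ∀ δ : ℝ, 0 < δ → ∃ (W' : EuclideanSpace ℝ (Fin 3) → EuclideanSpace ℝ (Fin 3)) (ρ' : ℝ),
      ContDiff ℝ ∞ W' ∧ VectorCalculus.IsDivFree W' ∧ tsupport W' ⊆ closedBall 0 ρ' ∧
      (∀ x, ‖W' x‖ < TowerRates.tuned.Y 0) ∧ ρ ≤ ρ' ∧ ∀ x, ‖W' x - W x‖ ≤ δ) :
    PalasekTowerBreakdown.EpisodeBaseT :=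
  episodeBaseGAt_of_boxNumerics_of_approximable_freeRun TowerRates.tuned_boxNumerics hW0 hρ hv hv1 hvE hη hcap
    hspeed hstrain hcore happrox

/-- **`EpisodeBaseT` FROM ONE FREE RUN OF THE CURL OF A SCHWARTZ POTENTIAL** (tuned twin of p523959's Schwartz form):
`A` smooth and Schwartz (`HasRapidSpatialDecay A`) with `‖DA(x)‖ ≤ L`, `4L < Y₀(tuned)`, `ρ ≥ 0`; ONE classical
finite-energy free run of `curl A` on `[1, τfirstAt tuned]` below `(5/3) Y₁ − η` showing the three tuned level-`1` faces
with margin `η > 0` inside `‖x‖ ≤ ρ` ⟹ `EpisodeBaseT` (the truncations `curl(χ_ρ A)` are the compact approximants,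
`Germ.exists_compact_truncation_curl_of_lt`). [cite: Palasek2026ElementaryModel, §4] [cite: MajdaBertozziCUP2002, §1.1 (1.11)] -/
theorem palasekTowerBreakdown_episodeBaseT_of_schwartz_potential_mechanism_freeRun
    {A : EuclideanSpace ℝ (Fin 3) → EuclideanSpace ℝ (Fin 3)} {ρ L : ℝ}
    (hA : ContDiff ℝ ∞ A) (hAdec : HasRapidSpatialDecay A) (hL : ∀ x, ‖fderiv ℝ A x‖ ≤ L)
    (h4L : 4 * L < TowerRates.tuned.Y 0) (hρ : 0 ≤ ρ)
    {v : ℝ → EuclideanSpace ℝ (Fin 3) → EuclideanSpace ℝ (Fin 3)} {q : ℝ → EuclideanSpace ℝ (Fin 3) → ℝ}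
    (hv : IsClassicalNSSolutionOn (Icc 1 (Host.τfirstAt TowerRates.tuned)) 1 0 v q) (hv1 : v 1 = curl A)
    (hvE : ∃ C : ℝ≥0∞, C < ⊤ ∧ ∀ t ∈ Icc (1 : ℝ) (Host.τfirstAt TowerRates.tuned), ∫⁻ x, ‖v t x‖ₑ ^ 2 ≤ C)
    {η : ℝ} (hη : 0 < η)
    (hcap : ∀ t ∈ Icc (1 : ℝ) (Host.τfirstAt TowerRates.tuned), ∀ x, ‖v t x‖ ≤ 5 / 3 * TowerRates.tuned.Y 1 - η)
    (hspeed : ∃ x, ‖x‖ ≤ ρ ∧ TowerRates.tuned.Y 1 + η ≤ ‖v (Host.τfirstAt TowerRates.tuned) x‖)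
    (hstrain : ∃ x, ‖x‖ ≤ ρ ∧ TowerRates.tuned.A 1 + η ≤ ‖fderiv ℝ (v (Host.τfirstAt TowerRates.tuned)) x‖)
    (hcore : ∃ (x : EuclideanSpace ℝ (Fin 3)) (γ : ℝ → EuclideanSpace ℝ (Fin 3)),
      ‖x‖ ≤ ρ ∧ ContDiff ℝ 1 γ ∧ γ 0 = γ 1 ∧
      (∀ s ∈ Icc (0 : ℝ) 1, γ s ∈ closedBall x (1 / TowerRates.tuned.N 1)) ∧
      (∀ s ∈ Icc (0 : ℝ) 1, ‖deriv γ s‖ ≤ 8 * Real.pi / TowerRates.tuned.N 1) ∧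
      TowerRates.tuned.N 1 ^ (TowerRates.tuned.β - 2) + η ≤ circulation (v (Host.τfirstAt TowerRates.tuned)) γ) :
    PalasekTowerBreakdown.EpisodeBaseT :=
  palasekTowerBreakdown_episodeBaseT_of_approximable_mechanism_freeRun (hasRapidSpatialDecay_curl hA hAdec) hρ hv
    hv1 hvE hη hcap hspeed hstrain hcore (fun _ hδ => exists_compact_truncation_curl_of_lt hA hAdec hL h4L ρ hδ)

end Summit.NavierStokesRegularity.NavierStokesRegularity.Theorems

end
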